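import Literature.Analysis.FluidPDE.SereginLocalStokesRegularity
import Literature.Analysis.FluidPDE.SpaceTimeMollifier
import Literature.Analysis.FunctionSpaces.MinkowskiIntegral
import HarnessLib

/-!
# Mixed norms `L_{s,n}` do not increase under space–time mollification

Analysis/FluidPDE support file (everything proved, no definitions, no named facts) on the
discharge path of the named fact `Literature.Analysis.FluidPDE.StokesLocalHolderBound`
(`FluidPDE/SereginLocalStokesRegularity`; G. Seregin, *Lecture notes on regularity theory for
the Navier–Stokes equations* (2014), §4.6, Prop. 6.7 & 6.8). The discharge regularises a
distributional Stokes solution by the space–time mollification `k ⋆ 𝟙_Q u`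
(`Fluid.stMollify`, `FluidPDE/SpaceTimeMollifier`) and needs the mixed norms
`‖·‖_{s,n,Q} = ‖·‖_{L_n(L_s)}` (`mixedNorm`, Seregin 2014, §4.4) of the regularised data to be
controlled by those of the data. This is **Minkowski's integral inequality, twice** (in `L_s` of
space for each time, then in `L_n` of time), with the translation invariance of Lebesgue measure
(the pointwise bound `‖(k ⋆ g)(z)‖ₑ ≤ ∫ ‖k(w)‖ₑ ‖g(z - w)‖ₑ dw` used in the first step is
`Literature.Analysis.UnboundedOperators.enorm_convolution_lsmul_le` from
`UnboundedOperators/HeatKernel`):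

* `globalMixedNorm_convolution_le` — for `1 ≤ s`, `1 ≤ n`, measurable `k` and strongly measurable
  `g` on `ℝ × ℝ³`,
  `(∫_t (∫_x ‖(k ⋆ g)(t,x)‖ˢ)^{n/s})^{1/n} ≤ ‖k‖_{L¹} (∫_t (∫_x ‖g(t,x)‖ˢ)^{n/s})^{1/n}`;
* `mixedNorm_le_globalMixedNorm`, `globalMixedNorm_indicator_eq_mixedNorm` — the cylinder norm is
  at most the whole-space norm, with equality for functions extended by zero off the cylinder;
* `mixedNorm_stMollify_indicator_le` — **the estimate used downstream**: for every cylinder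
  `Q(z', R')`,
  `‖k ⋆ (𝟙_{Q(z,R)} G)‖_{s,n,Q(z',R')} ≤ ‖k‖_{L¹} ‖G‖_{s,n,Q(z,R)}`;
* `stMollify_congr_ae` — mollifications of a.e.-equal fields coincide everywhere.

## References

* G. Seregin, *Lecture notes on regularity theory for the Navier–Stokes equations*, World
  Scientific (2014), §4.4 (the spaces `L_{s,l}(Q_T) = L_l(0,T; L_s(Ω))`). [`Seregin2014`]
* E. M. Stein, *Singular integrals and differentiability properties of functions* (1970),
  App. A.1 (Minkowski's integral inequality). [`Stein1971`]
-/

noncomputable section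

open MeasureTheory TopologicalSpace Set Function Filter Metric ContinuousLinearMap
open scoped ENNReal NNReal Convolution

namespace Literature.Analysis.FluidPDE

open Literature.Analysis.FunctionSpaces

variable {F : Type*} [NormedAddCommGroup F] [NormedSpace ℝ F]

/-! ### Convolutions and a.e.-modifications -/

section Pointwise

/-- **Mollifications of a.e.-equal fields coincide everywhere**: if `g = g'` a.e. on `ℝ × E`
then `k ⋆ g = k ⋆ g'` (each value is an integral against a translate of the data). [folklore] -/
theorem stMollify_congr_ae {E : Type*} [NormedAddCommGroup E] [InnerProductSpace ℝ E]
    [FiniteDimensional ℝ E] [MeasurableSpace E] [BorelSpace E] (k : ℝ × E → ℝ) {g g' : ℝ × E → F}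
    (h : g =ᵐ[volume] g') : stMollify k g = stMollify k g' := by
  haveI : (volume : Measure (ℝ × E)).IsAddHaarMeasure := Measure.prod.instIsAddHaarMeasure _ _
  funext t x
  rw [stMollify_eq_integral, stMollify_eq_integral]
  refine integral_congr_ae ?_
  filter_upwards [h] with w hw
  rw [hw]

end Pointwise

/-! ### Minkowski twice: the whole-space mixed norm of a convolution -/

section Minkowski

/-- **Mixed norms of convolutions** (Minkowski's integral inequality in space for each time, then
in time, and translation invariance): for `1 ≤ s`, `1 ≤ n`, a measurable kernel `k` and a
strongly measurable `g` on `ℝ × ℝ³`,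
`(∫_t (∫_x ‖(k ⋆ g)(t,x)‖ₑˢ dx)^{n/s} dt)^{1/n} ≤ (∫ ‖k‖ₑ) (∫_t (∫_x ‖g(t,x)‖ₑˢ dx)^{n/s} dt)^{1/n}`
(Seregin 2014, §4.4: `L_{s,l}` is a Banach space of `L_s`-valued functions; Young's inequality
`L¹ × L_{s,l} → L_{s,l}`). [cite: Stein1971, App. A.1 (Minkowski's integral inequality)] -/
theorem globalMixedNorm_convolution_le {s n : ℝ} (hs : 1 ≤ s) (hn : 1 ≤ n)
    {k : ℝ × EuclideanSpace ℝ (Fin 3) → ℝ} (hk : Measurable k)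
    {g : ℝ × EuclideanSpace ℝ (Fin 3) → F} (hg : StronglyMeasurable g) :
    (∫⁻ t : ℝ, (∫⁻ x : EuclideanSpace ℝ (Fin 3),
        ‖(k ⋆[lsmul ℝ ℝ, volume] g) (t, x)‖ₑ ^ s) ^ (n / s)) ^ (1 / n) ≤
      (∫⁻ w, ‖k w‖ₑ) *
        (∫⁻ t : ℝ, (∫⁻ x : EuclideanSpace ℝ (Fin 3), ‖g (t, x)‖ₑ ^ s) ^ (n / s)) ^ (1 / n) := by
  have hs0 : 0 < s := by linarith
  have hn0 : 0 < n := by linarith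
  -- the scalar data
  set Kn : ℝ × EuclideanSpace ℝ (Fin 3) → ℝ≥0∞ := fun w => ‖k w‖ₑ with hKn
  set Gn : ℝ × EuclideanSpace ℝ (Fin 3) → ℝ≥0∞ := fun z => ‖g z‖ₑ with hGn
  have hKm : Measurable Kn := hk.enorm
  have hGm : Measurable Gn := by
    have h1 : Measurable fun z => ‖g z‖ := hg.norm.measurable
    simpa only [hGn, ofReal_norm] using h1.ennreal_ofReal
  -- the slice norms of `g` and their measurability
  set B : ℝ → ℝ≥0∞ := fun τ => (∫⁻ x : EuclideanSpace ℝ (Fin 3), Gn (τ, x) ^ s) ^ (1 / s) with hB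
  have hBm : Measurable B :=
    ((hGm.pow_const s).lintegral_prod_right' (ν := (volume : Measure (EuclideanSpace ℝ (Fin 3))))).pow_const _
  have hpow : ∀ a : ℝ≥0∞, a ^ (n / s) = (a ^ (1 / s)) ^ n := fun a => by
    rw [← ENNReal.rpow_mul, one_div_mul_eq_div]
  have hrs : ∀ a : ℝ≥0∞, (a ^ s) ^ (1 / s) = a := fun a => by
    rw [← ENNReal.rpow_mul, mul_one_div_cancel hs0.ne', ENNReal.rpow_one]
  have hrn : ∀ a : ℝ≥0∞, (a ^ n) ^ (1 / n) = a := fun a => by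
    rw [← ENNReal.rpow_mul, mul_one_div_cancel hn0.ne', ENNReal.rpow_one]
  ------------------------------------------------------------------
  -- Step 1: for each time, Minkowski in space
  ------------------------------------------------------------------
  have hstep1 : ∀ t : ℝ, (∫⁻ x : EuclideanSpace ℝ (Fin 3),
      ‖(k ⋆[lsmul ℝ ℝ, volume] g) (t, x)‖ₑ ^ s) ^ (1 / s) ≤ ∫⁻ w, Kn w * B (t - w.1) := by
    intro t
    -- the integrand of Minkowski
    set f : EuclideanSpace ℝ (Fin 3) → ℝ × EuclideanSpace ℝ (Fin 3) → ℝ≥0∞ :=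
      fun x w => Kn w * Gn ((t, x) - w) with hf
    have hfm : Measurable (uncurry f) := by
      refine (hKm.comp measurable_snd).mul (hGm.comp ?_)
      exact (measurable_const.prodMk measurable_fst).sub measurable_snd
    calc (∫⁻ x : EuclideanSpace ℝ (Fin 3), ‖(k ⋆[lsmul ℝ ℝ, volume] g) (t, x)‖ₑ ^ s) ^ (1 / s)
        ≤ (∫⁻ x : EuclideanSpace ℝ (Fin 3), (∫⁻ w, f x w) ^ s) ^ (1 / s) := by
          refine ENNReal.rpow_le_rpow (lintegral_mono fun x => ?_) (by positivity)
          exact ENNReal.rpow_le_rpow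
            (UnboundedOperators.enorm_convolution_lsmul_le k g (t, x)) hs0.le
      _ ≤ ∫⁻ w, (∫⁻ x : EuclideanSpace ℝ (Fin 3), f x w ^ s) ^ (1 / s) :=
          rpow_inv_lintegral_rpow_lintegral_le hs hfm
      _ = ∫⁻ w, Kn w * B (t - w.1) := by
          refine lintegral_congr fun w => ?_
          have hm1 : Measurable fun x : EuclideanSpace ℝ (Fin 3) => Gn ((t, x) - w) ^ s :=
            (hGm.comp ((measurable_const.prodMk measurable_id).sub measurable_const)).pow_const s
          simp only [hf]
          simp_rw [ENNReal.mul_rpow_of_nonneg _ _ hs0.le]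
          rw [lintegral_const_mul _ hm1, ENNReal.mul_rpow_of_nonneg _ _ (by positivity), hrs]
          congr 1
          simp only [hB]
          congr 1
          exact lintegral_sub_right_eq_self (fun y => Gn (t - w.1, y) ^ s) w.2
  ------------------------------------------------------------------
  -- Step 2: Minkowski in time
  ------------------------------------------------------------------
  set f₂ : ℝ → ℝ × EuclideanSpace ℝ (Fin 3) → ℝ≥0∞ := fun t w => Kn w * B (t - w.1) with hf₂
  have hf₂m : Measurable (uncurry f₂) :=
    (hKm.comp measurable_snd).mul (hBm.comp (measurable_fst.sub (measurable_fst.comp measurable_snd)))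
  calc (∫⁻ t : ℝ, (∫⁻ x : EuclideanSpace ℝ (Fin 3),
          ‖(k ⋆[lsmul ℝ ℝ, volume] g) (t, x)‖ₑ ^ s) ^ (n / s)) ^ (1 / n)
      ≤ (∫⁻ t : ℝ, (∫⁻ w, f₂ t w) ^ n) ^ (1 / n) := by
        refine ENNReal.rpow_le_rpow (lintegral_mono fun t => ?_) (by positivity)
        rw [hpow]
        exact ENNReal.rpow_le_rpow (hstep1 t) hn0.le
    _ ≤ ∫⁻ w, (∫⁻ t : ℝ, f₂ t w ^ n) ^ (1 / n) := rpow_inv_lintegral_rpow_lintegral_le hn hf₂m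
    _ = ∫⁻ w, Kn w * (∫⁻ t : ℝ, B t ^ n) ^ (1 / n) := by
        refine lintegral_congr fun w => ?_
        have hm1 : Measurable fun t : ℝ => B (t - w.1) ^ n :=
          (hBm.comp (measurable_id.sub measurable_const)).pow_const n
        simp only [hf₂]
        simp_rw [ENNReal.mul_rpow_of_nonneg _ _ hn0.le]
        rw [lintegral_const_mul _ hm1, ENNReal.mul_rpow_of_nonneg _ _ (by positivity), hrn]
        congr 2
        exact lintegral_sub_right_eq_self (fun τ => B τ ^ n) w.1
    _ = (∫⁻ w, ‖k w‖ₑ) *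
          (∫⁻ t : ℝ, (∫⁻ x : EuclideanSpace ℝ (Fin 3), ‖g (t, x)‖ₑ ^ s) ^ (n / s)) ^ (1 / n) := by
        rw [lintegral_mul_const _ hKm]
        simp only [hKn, hB, hGn, ← hpow]

end Minkowski

/-! ### Cylinder norms versus whole-space norms -/

section Cylinder

variable {α : Type*} [ENorm α]

/-- The mixed norm on a cylinder is at most the whole-space mixed norm. [folklore] -/
theorem mixedNorm_le_globalMixedNorm {s n : ℝ} (hs : 0 ≤ s) (hn : 0 ≤ n)
    (z : ℝ × EuclideanSpace ℝ (Fin 3)) (R : ℝ) (G : ℝ × EuclideanSpace ℝ (Fin 3) → α) :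
    mixedNorm s n z R G ≤
      (∫⁻ t : ℝ, (∫⁻ x : EuclideanSpace ℝ (Fin 3), ‖G (t, x)‖ₑ ^ s) ^ (n / s)) ^ (1 / n) := by
  unfold mixedNorm
  refine ENNReal.rpow_le_rpow ?_ (by positivity)
  calc ∫⁻ t in Ioo (z.1 - R ^ 2) z.1, (∫⁻ x in ball z.2 R, ‖G (t, x)‖ₑ ^ s) ^ (n / s)
      ≤ ∫⁻ t in Ioo (z.1 - R ^ 2) z.1, (∫⁻ x, ‖G (t, x)‖ₑ ^ s) ^ (n / s) :=
        lintegral_mono fun t => ENNReal.rpow_le_rpow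
          (lintegral_mono' Measure.restrict_le_self le_rfl) (by positivity)
    _ ≤ ∫⁻ t, (∫⁻ x, ‖G (t, x)‖ₑ ^ s) ^ (n / s) := lintegral_mono' Measure.restrict_le_self le_rfl

/-- For a function extended by zero off the cylinder, the whole-space mixed norm is the cylinder
mixed norm (`0 < s`, `0 < n`). [folklore] -/
theorem globalMixedNorm_indicator_eq_mixedNorm {β : Type*} [NormedAddCommGroup β] {s n : ℝ}
    (hs : 0 < s) (hn : 0 < n) (z : ℝ × EuclideanSpace ℝ (Fin 3)) (R : ℝ)
    (G : ℝ × EuclideanSpace ℝ (Fin 3) → β) :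
    (∫⁻ t : ℝ, (∫⁻ x : EuclideanSpace ℝ (Fin 3),
        ‖(parabolicCylinder R z).indicator G (t, x)‖ₑ ^ s) ^ (n / s)) ^ (1 / n) =
      mixedNorm s n z R G := by
  unfold mixedNorm
  congr 1
  -- the time integrand vanishes off the time interval and restricts in space
  have hslice : ∀ t, (∫⁻ x : EuclideanSpace ℝ (Fin 3),
      ‖(parabolicCylinder R z).indicator G (t, x)‖ₑ ^ s) =
      (Ioo (z.1 - R ^ 2) z.1).indicator
        (fun t => ∫⁻ x in ball z.2 R, ‖G (t, x)‖ₑ ^ s) t := by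
    intro t
    by_cases ht : t ∈ Ioo (z.1 - R ^ 2) z.1
    · rw [indicator_of_mem ht, ← lintegral_indicator measurableSet_ball]
      refine lintegral_congr fun x => ?_
      by_cases hx : x ∈ ball z.2 R
      · rw [indicator_of_mem hx, indicator_of_mem (show (t, x) ∈ parabolicCylinder R z from
          mk_mem_prod ht hx)]
      · rw [indicator_of_notMem hx, indicator_of_notMem (show (t, x) ∉ parabolicCylinder R z from
          fun h => hx h.2), enorm_zero, ENNReal.zero_rpow_of_pos hs]
    · rw [indicator_of_notMem ht]
      have h0 : ∀ x : EuclideanSpace ℝ (Fin 3),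
          ‖(parabolicCylinder R z).indicator G (t, x)‖ₑ ^ s = 0 := fun x => by
        rw [indicator_of_notMem (show (t, x) ∉ parabolicCylinder R z from fun h => ht h.1),
          enorm_zero, ENNReal.zero_rpow_of_pos hs]
      calc (∫⁻ x : EuclideanSpace ℝ (Fin 3), ‖(parabolicCylinder R z).indicator G (t, x)‖ₑ ^ s)
          = ∫⁻ _x : EuclideanSpace ℝ (Fin 3), (0 : ℝ≥0∞) := lintegral_congr h0
        _ = 0 := lintegral_zero
  simp_rw [hslice]
  rw [← lintegral_indicator measurableSet_Ioo]
  refine lintegral_congr fun t => ?_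
  by_cases ht : t ∈ Ioo (z.1 - R ^ 2) z.1
  · rw [indicator_of_mem ht, indicator_of_mem ht]
  · rw [indicator_of_notMem ht, indicator_of_notMem ht, ENNReal.zero_rpow_of_pos (by positivity)]

/-- **Mixed norms do not increase under space–time mollification.** For `1 ≤ s`, `1 ≤ n`, a
measurable kernel `k` on `ℝ × ℝ³`, a strongly measurable `G` and any two cylinders,
`‖k ⋆ (𝟙_{Q(z,R)} G)‖_{s,n,Q(z',R')} ≤ (∫ ‖k‖ₑ) ‖G‖_{s,n,Q(z,R)}` (for a unit-mass nonnegative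
mollifier the factor is `1`). [cite: Stein1971, App. A.1 (Minkowski's integral inequality)] -/
theorem mixedNorm_stMollify_indicator_le {s n : ℝ} (hs : 1 ≤ s) (hn : 1 ≤ n)
    {k : ℝ × EuclideanSpace ℝ (Fin 3) → ℝ} (hk : Measurable k)
    {G : ℝ × EuclideanSpace ℝ (Fin 3) → F} (hG : StronglyMeasurable G)
    (z z' : ℝ × EuclideanSpace ℝ (Fin 3)) (R R' : ℝ) :
    mixedNorm s n z' R' (uncurry (stMollify k ((parabolicCylinder R z).indicator G))) ≤
      (∫⁻ w, ‖k w‖ₑ) * mixedNorm s n z R G := by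
  have hs0 : 0 < s := by linarith
  have hn0 : 0 < n := by linarith
  have hGi : StronglyMeasurable ((parabolicCylinder R z).indicator G) :=
    hG.indicator (isOpen_parabolicCylinder R z).measurableSet
  calc mixedNorm s n z' R' (uncurry (stMollify k ((parabolicCylinder R z).indicator G)))
      ≤ (∫⁻ t : ℝ, (∫⁻ x : EuclideanSpace ℝ (Fin 3),
          ‖uncurry (stMollify k ((parabolicCylinder R z).indicator G)) (t, x)‖ₑ ^ s) ^ (n / s)) ^
          (1 / n) := mixedNorm_le_globalMixedNorm hs0.le hn0.le z' R' _
    _ ≤ (∫⁻ w, ‖k w‖ₑ) * (∫⁻ t : ℝ, (∫⁻ x : EuclideanSpace ℝ (Fin 3),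
          ‖(parabolicCylinder R z).indicator G (t, x)‖ₑ ^ s) ^ (n / s)) ^ (1 / n) := by
        simp only [uncurry_stMollify]
        exact globalMixedNorm_convolution_le hs hn hk hGi
    _ = (∫⁻ w, ‖k w‖ₑ) * mixedNorm s n z R G := by
        rw [globalMixedNorm_indicator_eq_mixedNorm hs0 hn0 z R G]

end Cylinder

end Literature.Analysis.FluidPDE

end
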